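import Summits.BirchSwinnertonDyer.Rank1Residual.Partition.Bsdp
import Summits.BirchSwinnertonDyer.Rank1Residual.X12.CMRamifiedAdditive
import Literature.NumberTheory.EllipticCurves.LiTianYanZhu2025.CMRankOnePPart
import HarnessLib

/-!
# The CM axis of the strong partial theorem: `BSD(E,p)` outside the CM corner (cell `b2b-bsdres`,
# RESIDUAL-MAP.md §F CORNER PREDICATE, rmap-3 gen 2; coordinator ruling 2026-08-20T22:24Z)

HONEST FRAMING (run/shared/lean/b2b/bsd-rank1-residual/, verbatim in every file): the goal of the
cell is to DELETE the COMBINATION-SHAPED residual classes of the Birch–Swinnerton-Dyer formula for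
ALL analytic-rank `≤ 1` elliptic curves over `ℚ` — "full BSD formula for every rank `≤ 1` curve in
class `C`" assembled STRICTLY from published theorems — so that the rank-`≤ 1` remainder becomes
exactly the CONSTRUCTION-SHAPED classes, which are TYPED (missing-input `Prop`s), NOT attempted.
This is not "finishing BSD". Nothing here is a Literature statement; NO named fact is introduced;
every theorem below is an assembly of `Partition/Bsdp.lean`'s covered-row bindings for the three CM
rows — `RowC8.bsdp` (Rubin 1991 / Burungale–Flach 2024 Thm 1.1 + Cor 2: CM, `r = 0`, EVERY prime),
`RowC17.bsdp` (Li–Liu–Tian 2024 Thm 1.1 (i): CM, `r = 1`, odd `p` SPLIT in `K`, any reduction type)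
and `RowC10.bsdp` (Kobayashi 2013 Cor 1.4, PUB[sec] flag `KOB13-primary-unread`: CM, `r = 1`, odd
GOOD `p`) — so exactly FOUR named published facts enter (`hCM`, `hmod`, `hLLT`, `hKob`), each
already consumed by `bsdp_of_covered` (p199353) and carrying its flag in HOME/CITED-FACTS.md.

THE STATEMENT (RESIDUAL-MAP.md §F CORNER PREDICATE ⟦rmap-3 g2, 2026-08-20T22:37Z⟧). On the domain
`D_F := {(W, p) : W/ℚ has CM, analyticRank W ≤ 1, p any prime}` put
`CornerF W p := W.HasCM ∧ analyticRank W = 1 ∧ (p = 2 ∨ (¬ CMSplit W p ∧ ¬ Good W p))`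
— the residual CM cell of the tree table (`Cell.classify` step 5 after steps 2 / 3 / 4 of
HOME/PARTITION.md §3), contained in the printed class predicate `ClassX12` (`cornerF_classX12`),
whose extra members "`p = 3` good inert" and "bad split `p`" are covered (rows C10 / C17). Then
`¬ CornerF W p → BSDp W p` for every CM pair of analytic rank `≤ 1` (`bsdp_cm_of_not_cornerF`):
rank `0` at every prime (C8); rank `1` at an odd prime split in `K` (C17, good OR bad reduction);
rank `1` at an odd good prime not split in `K`, i.e. inert of good supersingular reduction (C10).
The corner splits as (K12i) odd inert BAD `p` (RESIDUAL-MAP §I O10), (K12r) odd ramified `p`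
(O11; `p ∣ d_K` forces bad reduction, `not_good_of_cmRamified`), (K12₂) `p = 2` in rank one (O12):
`cornerF_iff_inert_bad_or_ramified_or_two`. At `p ≥ 11` (indeed at every odd `p`) the corner is
exactly "rank `1`, `p ∣ N`, `p` not split in `K`" (`cornerF_iff_of_ne_two`).

Combined with `Partition/Corners.lean` (rmap-1 gen 2: the non-CM axes §A/§B/§C,
`bsdp_of_not_corner` under `¬ W.HasCM`) this gives the headline for ALL curves, CM or not, with NO
CM corner inside its domain (odd good `p`; odd multiplicative `p` with `r = 0` — a CM curve is never
multiplicative, but the proof does not even need that: rank `0` is row C8 at every prime):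
`bsdp_allCurves_of_not_corner` in the sibling file `Partition/CornersAll.lean`. (The good-odd special case with the CM split internal is already
`StrongPartial.bsdp_of_good_odd_of_not_corner` / `bsdp_of_hasCM_of_good_odd`; the present file adds
the bad split primes, `p = 2` in rank `0` and the exact complement `¬ CornerF`; the all-curves form
of `Corners.bsdp_of_not_corner` is `Partition/CornersAll.lean`.)

References: RESIDUAL-MAP.md §F (CORNER PREDICATE), §I (HEADLINE DELIVERABLE, O10–O12);
HOME/PARTITION.md §3 steps 2–5; `Partition/Bsdp.lean` (`RowC8.bsdp`, `RowC10.bsdp`, `RowC17.bsdp`);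
`Partition/Corners.lean`; `X12/CMRamifiedAdditive.lean` (`not_good_of_cmRamified`).
-/

namespace Summit.BirchSwinnertonDyer.Rank1Residual

open WeierstrassCurve Literature.NumberTheory.EllipticCurves
  Literature.NumberTheory.EllipticCurves.Rank1Residual Literature.NumberTheory.EllipticCurves.ModularForms
open scoped NumberField

section Curve

variable {W : WeierstrassCurve ℚ} [W.IsElliptic] [W.IsGloballyMinimal] {p : ℕ} [Fact p.Prime]

/-! ### The CM corner predicate -/

omit [W.IsGloballyMinimal] in
variable (W p) in
/-- **CORNER_F** (RESIDUAL-MAP.md §F): the residual CM cell — CM, analytic rank one, and either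
`p = 2` or `p` is a BAD prime NOT split in the CM field `K` (inert-bad K12i, or ramified K12r).
This is `Cell.classify` step 5 (X12) AFTER steps 2 (C8: `r = 0`), 3 (C17: split) and 4 (C10: good)
of HOME/PARTITION.md §3. [folklore] -/
def CornerF : Prop :=
  W.HasCM ∧ W.analyticRank = 1 ∧ (p = 2 ∨ (¬ CMSplit W p ∧ ¬ Good W p))

omit [W.IsGloballyMinimal] in
/-- Unfolding of `CornerF`. [folklore] -/
theorem cornerF_iff :
    CornerF W p ↔ W.HasCM ∧ W.analyticRank = 1 ∧ (p = 2 ∨ (¬ CMSplit W p ∧ ¬ Good W p)) :=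
  Iff.rfl

omit [W.IsGloballyMinimal] in
/-- **`CornerF ⊆ ClassX12`**: the residual CM cell lies inside the printed class predicate X12 of
RESIDUAL-CASES §a.2 (`ClassX12 := cm ∧ r = 1 ∧ (p = 2 ∨ (p = 3 ∧ ¬split) ∨ ramified ∨ ¬good)`);
the converse fails exactly on X12's covered members (`p = 3` good inert: row C10; bad split `p`:
row C17). [folklore] -/
theorem cornerF_classX12 (h : CornerF W p) : ClassX12 W p := by
  obtain ⟨hcm, hr1, hp⟩ := h
  refine ⟨hcm, hr1, ?_⟩
  rcases hp with hp2 | ⟨-, hng⟩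
  · exact Or.inl hp2
  · exact Or.inr (Or.inr (Or.inr hng))

omit [W.IsGloballyMinimal] in
/-- **At an odd prime the CM corner is "rank `1`, bad, not split"**: for `p ≠ 2`,
`CornerF W p ↔ cm ∧ r = 1 ∧ ¬ Good W p ∧ ¬ CMSplit W p`. In particular this is the shape of the
corner at every `p ≥ 11` (RESIDUAL-MAP §F 'SPECIALISATION p ≥ 11'). [folklore] -/
theorem cornerF_iff_of_ne_two (hp : p ≠ 2) :
    CornerF W p ↔ W.HasCM ∧ W.analyticRank = 1 ∧ ¬ Good W p ∧ ¬ CMSplit W p := by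
  constructor
  · rintro ⟨hcm, hr1, h⟩
    rcases h with h2 | ⟨hns, hng⟩
    · exact absurd h2 hp
    · exact ⟨hcm, hr1, hng, hns⟩
  · rintro ⟨hcm, hr1, hng, hns⟩
    exact ⟨hcm, hr1, Or.inr ⟨hns, hng⟩⟩

omit [W.IsGloballyMinimal] in
/-- **The three sub-corners** (RESIDUAL-MAP §F: K12i inert-bad = §I O10, K12r ramified = O11,
K12₂ `p = 2` = O12): for a CM curve of analytic rank one, `CornerF W p` iff `p = 2`, or `p` is odd,
ramified in `K` (then automatically bad: `not_good_of_cmRamified`), or `p` is odd, inert in `K`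
(`CMInert := ¬ramified ∧ ¬split`) and bad. [folklore] -/
theorem cornerF_iff_inert_bad_or_ramified_or_two (hcm : W.HasCM) (hr1 : W.analyticRank = 1) :
    CornerF W p ↔
      p = 2 ∨ (p ≠ 2 ∧ CMRamified W p) ∨ (p ≠ 2 ∧ CMInert W p ∧ ¬ Good W p) := by
  constructor
  · rintro ⟨-, -, h⟩
    rcases h with h2 | ⟨hns, hng⟩
    · exact Or.inl h2
    · by_cases hp : p = 2
      · exact Or.inl hp
      · by_cases hram : CMRamified W p
        · exact Or.inr (Or.inl ⟨hp, hram⟩)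
        · exact Or.inr (Or.inr ⟨hp, ⟨hram, hns⟩, hng⟩)
  · intro h
    refine ⟨hcm, hr1, ?_⟩
    rcases h with h2 | ⟨hp, hram⟩ | ⟨-, ⟨-, hns⟩, hng⟩
    · exact Or.inl h2
    · exact Or.inr ⟨fun hs ↦ hs.1 hram, X12.not_good_of_cmRamified W p hcm hp hram⟩
    · exact Or.inr ⟨hns, hng⟩

/-! ### The CM axis: covered ⟺ not corner -/

/-- **CM AXIS OF THE STRONG PARTIAL THEOREM (RESIDUAL-MAP §F corner predicate).** Granted the four
named published facts of the CM rows — the CM triple `hCM` (Rubin 1991 / Burungale–Flach 2024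
Thm 1.1 + Cor 2) with modularity `hmod` (row C8), Li–Liu–Tian 2024 Thm 1.1 (i) `hLLT` (row C17) and
Kobayashi 2013 Cor 1.4 `hKob` (row C10, PUB[sec]) —: for `W/ℚ` globally minimal elliptic WITH CM
and of analytic rank `≤ 1`, and ANY prime `p`, Miller's `BSD(E,p)` holds unless `(W, p)` is in the
CM corner `CornerF W p` (rank one and: `p = 2`, or `p` bad and not split in `K`). Proof: rank `0`
⇒ row C8 at every prime; rank `1` ⇒ `p ≠ 2` (else corner), then split ⇒ C17, good ⇒ C10, and
'neither' is the corner. [folklore] -/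
theorem bsdp_cm_of_not_cornerF (hCM : bsdTriple_of_hasCM_of_L_one_ne_zero)
    (hmod : hasEntireLFunction_rat) (hLLT : LiLiuTian2024.thm11_bsdp_of_cm_rank_one)
    (hKob : Kobayashi2013.cor14_bsdp_of_cm_rank_one)
    (hcm : W.HasCM) (hr : W.analyticRank ≤ 1) (hX : ¬ CornerF W p) : BSDp W p := by
  have hrk : W.analyticRank = 0 ∨ W.analyticRank = 1 := by omega
  rcases hrk with hr0 | hr1
  · exact RowC8.bsdp hCM hmod ⟨hcm, hr0⟩
  · have hp2 : p ≠ 2 := fun h2 ↦ hX ⟨hcm, hr1, Or.inl h2⟩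
    by_cases hs : CMSplit W p
    · exact RowC17.bsdp hLLT ⟨hcm, hr1, hp2, hs⟩
    · by_cases hg : Good W p
      · exact RowC10.bsdp hKob ⟨hcm, hr1, hp2, hg⟩
      · exact absurd ⟨hcm, hr1, Or.inr ⟨hs, hg⟩⟩ hX

/-- **CM, rank `0`: every prime, every reduction type** (row C8 alone; `p = 2`, `p = 3` and the
bad primes included — RESIDUAL-MAP §F first row / §S). [folklore] -/
theorem bsdp_cm_rankZero (hCM : bsdTriple_of_hasCM_of_L_one_ne_zero)
    (hmod : hasEntireLFunction_rat) (hcm : W.HasCM) (hr0 : W.analyticRank = 0) : BSDp W p :=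
  RowC8.bsdp hCM hmod ⟨hcm, hr0⟩

/-- **CM, rank `≤ 1`, odd prime SPLIT in `K`: any reduction type** (good ordinary, or additive
potentially good ordinary — e.g. `2304k1` at `p = 3`, `K = ℚ(√−2)`): rows C8 / C17. [folklore] -/
theorem bsdp_cm_of_cmSplit_of_ne_two (hCM : bsdTriple_of_hasCM_of_L_one_ne_zero)
    (hmod : hasEntireLFunction_rat) (hLLT : LiLiuTian2024.thm11_bsdp_of_cm_rank_one)
    (hKob : Kobayashi2013.cor14_bsdp_of_cm_rank_one)
    (hcm : W.HasCM) (hr : W.analyticRank ≤ 1) (hp : p ≠ 2) (hs : CMSplit W p) : BSDp W p :=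
  bsdp_cm_of_not_cornerF hCM hmod hLLT hKob hcm hr fun ⟨_, _, h⟩ ↦ by
    rcases h with h2 | ⟨hns, -⟩
    · exact hp h2
    · exact hns hs

/-- **CM, rank `≤ 1`, odd GOOD prime (split or inert)**: rows C8 / C17 / C10 — the CM pairs inside
the headline's domain carry NO corner (= `StrongPartial.bsdp_of_hasCM_of_good_odd`, re-derived from
the corner form). [folklore] -/
theorem bsdp_cm_of_good_of_ne_two (hCM : bsdTriple_of_hasCM_of_L_one_ne_zero)
    (hmod : hasEntireLFunction_rat) (hLLT : LiLiuTian2024.thm11_bsdp_of_cm_rank_one)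
    (hKob : Kobayashi2013.cor14_bsdp_of_cm_rank_one)
    (hcm : W.HasCM) (hr : W.analyticRank ≤ 1) (hp : p ≠ 2) (hg : Good W p) : BSDp W p :=
  bsdp_cm_of_not_cornerF hCM hmod hLLT hKob hcm hr fun ⟨_, _, h⟩ ↦ by
    rcases h with h2 | ⟨-, hng⟩
    · exact hp h2
    · exact hng hg

/-- **The CM corner at `p ≥ 11` (indeed at any odd `p`) is exactly "rank `1`, `p ∣ N`, `p` not split
in `K`"**: outside it, `BSD(E,p)`. [folklore] -/
theorem bsdp_cm_of_eleven_le (hCM : bsdTriple_of_hasCM_of_L_one_ne_zero)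
    (hmod : hasEntireLFunction_rat) (hLLT : LiLiuTian2024.thm11_bsdp_of_cm_rank_one)
    (hKob : Kobayashi2013.cor14_bsdp_of_cm_rank_one)
    (hcm : W.HasCM) (hr : W.analyticRank ≤ 1) (h11 : 11 ≤ p)
    (hX : ¬ (W.analyticRank = 1 ∧ ¬ Good W p ∧ ¬ CMSplit W p)) : BSDp W p :=
  bsdp_cm_of_not_cornerF hCM hmod hLLT hKob hcm hr fun h ↦
    hX (((cornerF_iff_of_ne_two (W := W) (by omega)).1 h).2)

/-! ### The CM corner SHARPENED at `p = 2` after Li–Tian–Yan–Zhu 2025 (appended, rmap-3 gen 3;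
RESIDUAL-MAP.md §F `SIGNED §F addendum 2 rmap-3 g3`, register T18) -/

variable (W p) in
/-- **CORNER_F♯** (RESIDUAL-MAP.md §F, the residue K12₂′ ∪ K12i ∪ K12r): CM, analytic rank one, and
EITHER `p = 2` with `2` NOT a prime of good ordinary reduction (i.e. `2 ∣ N`, or `2` good and
non-ordinary = inert in `K`), OR `p` odd, bad and not split in `K`. This is `CornerF` with the
sub-cell '`p = 2`, good ordinary at `2`' (CM field `ℚ(√−7)`, `2 ∤ N`) REMOVED — that sub-cell is
covered in refereed print by Li–Tian–Yan–Zhu, PAMQ 21 (2025) Thm 1.1 (ii) (named fact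
`LiTianYanZhu2025.thm11_bsdp_of_cm_rank_one`, lit-bst gen 3). [folklore] -/
def CornerFSharp : Prop :=
  W.HasCM ∧ W.analyticRank = 1 ∧ ((p = 2 ∧ ¬ GoodOrd W 2) ∨ (p ≠ 2 ∧ ¬ CMSplit W p ∧ ¬ Good W p))

/-- `CornerF♯ ⊆ CornerF`. [folklore] -/
theorem cornerF_of_cornerFSharp (h : CornerFSharp W p) : CornerF W p := by
  obtain ⟨hcm, hr1, h⟩ := h
  rcases h with ⟨h2, -⟩ | ⟨-, hns, hng⟩
  · exact ⟨hcm, hr1, Or.inl h2⟩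
  · exact ⟨hcm, hr1, Or.inr ⟨hns, hng⟩⟩

/-- **`CornerF` = `CornerF♯` ⊔ the LTYZ sub-cell**: the old corner exceeds the sharp one exactly by
'CM, rank one, `p = 2`, good ordinary at `2`'. [folklore] -/
theorem cornerF_iff_cornerFSharp_or_goodOrd_two :
    CornerF W p ↔ CornerFSharp W p ∨ (W.HasCM ∧ W.analyticRank = 1 ∧ p = 2 ∧ GoodOrd W 2) := by
  constructor
  · rintro ⟨hcm, hr1, h⟩
    rcases h with h2 | ⟨hns, hng⟩
    · by_cases hgo : GoodOrd W 2
      · exact Or.inr ⟨hcm, hr1, h2, hgo⟩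
      · exact Or.inl ⟨hcm, hr1, Or.inl ⟨h2, hgo⟩⟩
    · by_cases hp2 : p = 2
      · subst hp2
        by_cases hgo : GoodOrd W 2
        · exact Or.inr ⟨hcm, hr1, rfl, hgo⟩
        · exact Or.inl ⟨hcm, hr1, Or.inl ⟨rfl, hgo⟩⟩
      · exact Or.inl ⟨hcm, hr1, Or.inr ⟨hp2, hns, hng⟩⟩
  · rintro (h | ⟨hcm, hr1, h2, -⟩)
    · exact cornerF_of_cornerFSharp h
    · exact ⟨hcm, hr1, Or.inl h2⟩

/-- At an odd prime the two corners agree. [folklore] -/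
theorem cornerFSharp_iff_cornerF_of_ne_two (hp : p ≠ 2) : CornerFSharp W p ↔ CornerF W p := by
  rw [cornerF_iff_cornerFSharp_or_goodOrd_two]
  constructor
  · exact Or.inl
  · rintro (h | ⟨-, -, h2, -⟩)
    · exact h
    · exact absurd h2 hp

/-- **STRONG PARTIAL THEOREM ON THE CM AXIS, SHARP AT `2` (RESIDUAL-MAP §F after T18).** Granted the
four named published facts of the CM rows PLUS Li–Tian–Yan–Zhu 2025 Thm 1.1 (`hLTYZ`, PUB; flag
`LTYZ25-authors-version`): for `W/ℚ` globally minimal elliptic WITH CM and of analytic rank `≤ 1`, and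
ANY prime `p`, `BSD(E,p)` holds unless `(W, p)` is in the SHARP corner `CornerF♯ W p` — rank one
and: `p = 2` with `2 ∣ N` or `2` non-ordinary, or `p` odd, bad and not split in `K`. Proof: outside
`CornerF` by `bsdp_cm_of_not_cornerF`; on the removed sub-cell (`p = 2`, good ordinary at `2`,
rank one) by `LiTianYanZhu2025.bsdp_two_of_goodOrd`. [folklore] -/
theorem bsdp_cm_of_not_cornerFSharp (hCM : bsdTriple_of_hasCM_of_L_one_ne_zero)
    (hmod : hasEntireLFunction_rat) (hLLT : LiLiuTian2024.thm11_bsdp_of_cm_rank_one)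
    (hKob : Kobayashi2013.cor14_bsdp_of_cm_rank_one)
    (hLTYZ : LiTianYanZhu2025.thm11_bsdp_of_cm_rank_one)
    (hcm : W.HasCM) (hr : W.analyticRank ≤ 1) (hX : ¬ CornerFSharp W p) : BSDp W p := by
  by_cases hF : CornerF W p
  · rcases (cornerF_iff_cornerFSharp_or_goodOrd_two.1 hF) with h | ⟨-, hr1, hp2, hgo⟩
    · exact absurd h hX
    · subst hp2
      exact LiTianYanZhu2025.bsdp_two_of_goodOrd hLTYZ W hcm hgo.1 hgo.2 hr1
  · exact bsdp_cm_of_not_cornerF hCM hmod hLLT hKob hcm hr hF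

/-- **CM at `p = 2`, rank `≤ 1`, good ORDINARY reduction at `2`** (forces `K = ℚ(√−7)`): `BSD(E,2)`
— rank `0` by row C8, rank `1` by LTYZ 2025 Thm 1.1 (ii). The first COVERED rank-one CELL at `p = 2`
on the map (RESIDUAL-MAP §F row 'p = 2' (i), §S.4). [folklore] -/
theorem bsdp_cm_two_of_goodOrd (hCM : bsdTriple_of_hasCM_of_L_one_ne_zero)
    (hmod : hasEntireLFunction_rat) (hLTYZ : LiTianYanZhu2025.thm11_bsdp_of_cm_rank_one)
    (hcm : W.HasCM) (hr : W.analyticRank ≤ 1) (hgo : GoodOrd W 2) : BSDp W 2 := by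
  have hrk : W.analyticRank = 0 ∨ W.analyticRank = 1 := by omega
  rcases hrk with hr0 | hr1
  · exact RowC8.bsdp hCM hmod ⟨hcm, hr0⟩
  · exact LiTianYanZhu2025.bsdp_two_of_goodOrd hLTYZ W hcm hgo.1 hgo.2 hr1

/-! ### The map at `p = 2` in one line (appended, rmap-3 gen 3; RESIDUAL-MAP.md §S.4 / §S.5) -/

/-- **THE PARTITION AT `p = 2` (RESIDUAL-MAP §S.4 as one kernel statement).** For EVERY globally
minimal elliptic `W/ℚ` of analytic rank `≤ 1`: granted the four named CM facts and Li–Tian–Yan–Zhu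
2025 Thm 1.1, EITHER `BSD(E,2)` holds, OR `W` is non-CM (then `(W, 2)` is class X5 — every general
`p`-part theorem in print assumes `p` odd; per pair `2`-descent decides), OR `(W, 2)` lies in the
sharp CM corner `CornerF♯ W 2` (CM, rank one, `2 ∣ N` or `2` non-ordinary). The COVERED part at `2`
is thus exactly: CM ∧ `r = 0` (row C8, every prime) and CM ∧ `r = 1` ∧ good ordinary at `2`
(T18, `K = ℚ(√−7)`); the Li–Liu–Tian Thm 1.2 congruent-number sub-family sits inside the corner as a
covered one-parameter family (kernel `LiLiuTian2024.thm12_bsd_congruentNumberCurve`, not used here).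
[folklore] -/
theorem bsdp_two_or_not_hasCM_or_cornerFSharp (hCM : bsdTriple_of_hasCM_of_L_one_ne_zero)
    (hmod : hasEntireLFunction_rat) (hLLT : LiLiuTian2024.thm11_bsdp_of_cm_rank_one)
    (hKob : Kobayashi2013.cor14_bsdp_of_cm_rank_one)
    (hLTYZ : LiTianYanZhu2025.thm11_bsdp_of_cm_rank_one) (hr : W.analyticRank ≤ 1) :
    BSDp W 2 ∨ ¬ W.HasCM ∨ CornerFSharp W 2 := by
  by_cases hcm : W.HasCM
  · by_cases hX : CornerFSharp W 2
    · exact Or.inr (Or.inr hX)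
    · exact Or.inl (bsdp_cm_of_not_cornerFSharp hCM hmod hLLT hKob hLTYZ hcm hr hX)
  · exact Or.inr (Or.inl hcm)

/-- **`CornerF♯` at `p = 2` unfolded**: CM, rank one, and `2` is NOT a prime of good ordinary
reduction. [folklore] -/
theorem cornerFSharp_two_iff : CornerFSharp W 2 ↔ W.HasCM ∧ W.analyticRank = 1 ∧ ¬ GoodOrd W 2 := by
  constructor
  · rintro ⟨hcm, hr1, h⟩
    rcases h with ⟨-, hgo⟩ | ⟨h2, -, -⟩
    · exact ⟨hcm, hr1, hgo⟩
    · exact absurd rfl h2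
  · rintro ⟨hcm, hr1, hgo⟩
    exact ⟨hcm, hr1, Or.inl ⟨rfl, hgo⟩⟩

end Curve

end Summit.BirchSwinnertonDyer.Rank1Residual
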